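import Summits.BirchSwinnertonDyer.BirchSwinnertonDyer.Theorems.SignedBaseChangeAnticyclotomicEisensteinDivisibilityFinitePieceKernel
import Literature.NumberTheory.EllipticCurves.H1SigmaDualFiniteProofs
import Literature.NumberTheory.EllipticCurves.ZpExtensionUnramifiedProofs
import Literature.NumberTheory.EllipticCurves.TwoVariableSelmerTower
import HarnessLib

/-!
# `H¹_{nr,v̄}(K̃_∞, E[p^∞])[𝔪]` is finite — registered stub `stub_finitePieceSS` of line `bdpline`
# (crux `AnticyclotomicEisensteinDivisibility`, stmt-BirchSwinnertonDyer-20727, route `SignedBaseChange`)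

For ANY number field `K`, elliptic curve `E/K` (Weierstrass model `W`), prime `p`, pair of
`ℤ_p`-extensions `(κ₁, κ₂)` with a topological generator pair `(γ₁, γ₂)` and place `v̄`, the classes of
the two-variable unramified Selmer group `unrSelmer₂ κ₁ κ₂ E[p^∞] v̄ ⊆ H¹(K̃_∞, E[p^∞])`
(`K̃_∞ = K̄^{pairKer κ₁ κ₂}`) killed by `p` and fixed by `conj_{γ₁}` and `conj_{γ₂}` form a FINITE set
(`stub_finitePieceSS`). This is the Pontryagin dual of "`X_Gr₂/𝔪 X_Gr₂` is finite",
`𝔪 = (p, T₁, T₂)`, the input of the two-variable Nakayama lemma (`stub_nakayamaDualTwoVar`) giving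
`Module.Finite Λ₂ X_Gr(E/K̃_∞)` in the line's composition — Greenberg, LNM 1716 §1 p. 60 ("`X/𝔪X` is
finite … This can actually be proved for any prime `p`") over the `ℤ_p²`-tower.

Proof = the tree's one-variable assembly `WeierstrassCurve.finite_setOf_unramifiedOutside_pTorsion_conjH1_eq`
(H1SigmaDualFiniteProofs §2) run at level `H = pairKer κ₁ κ₂` with TWO invariance conditions:
(A) Kummer lift `H¹(H, E[p]) ↠ H¹(H, E[p^∞])[p]` with finite kernel `F₀`
(`exists_torsionToPrimaryH1Sub_eq`, `finite_ker_torsionToPrimaryH1Sub`); (B') lifts of unramified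
classes die on every inertia group above good `v ∤ p` (`resOfLe_eq_zero_of_mem_unramifiedOutside`);
(D₂) **the `γ₁`- and `γ₂`-invariant classes of `H¹(H, E[p])` unramified outside `S` are finite**
(`finite_setOf_conjH1_pair_eq_of_unramified`): by the RELATIVE descent
`exists_resOfLe_eq_of_conjH1_eq_pair` (sibling file) a `γ₂`-invariant class is `res z`,
`z ∈ H¹(ker κ₁, E[p])`, `z` is unramified outside `S` (inertia outside `p` lies in `pairKer`,
`ZpExtension.inertia_le_kerSubgroup_holds`), and `conj_{γ₁} z − z` lies in the FINITE kernel of `res`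
(`finite_ker_resOfLe_pair`), so `z` ranges over finitely many translates of the finite set of
`γ₁`-invariant unramified classes (the tree's one-variable `finite_setOf_conjH1_eq_of_unramified_of`,
Silverman X.4.3). References: Greenberg LNM 1716 §1 p. 60, §3 Lemma 3.2; Silverman AEC X.4.3–4.4.
BSD is not proved by any of this.
-/

-- D-0017: single-problem summit, the namespace repeats the problem name by design.
set_option linter.dupNamespace false
set_option autoImplicit false

open Literature.NumberTheory.EllipticCurves Literature.NumberTheory.GaloisRepresentations
open Literature.NumberTheory.EllipticCurves.GreenbergVatsal2000
open NumberField IsDedekindDomain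

namespace Summit.BirchSwinnertonDyer.BirchSwinnertonDyer.Theorems.SignedBaseChangeAcDivFinitePiece

universe u

section General

variable {K : Type u} [Field K] [NumberField K] {p : ℕ} [Fact p.Prime]
  {κ₁ κ₂ : ZpExtension K p} {γ₁ γ₂ : Field.absoluteGaloisGroup K}

omit [NumberField K] in
/-- Transitivity of restriction, applied: `res_{I ≤ H} (res_{H ≤ H'} z) = res_{I ≤ H'} z`.
[cite: NeukirchSchmidtWingberg2008, I.§5] -/
theorem resOfLe_resOfLe {M : Type u} [AddCommGroup M] [DistribMulAction (Field.absoluteGaloisGroup K) M]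
    [TopologicalSpace M] [DiscreteTopology M] {I H H' : Subgroup (Field.absoluteGaloisGroup K)}
    (h : I ≤ H) (h' : H ≤ H') (z : subgroupH1 H' M) :
    resOfLe M h (resOfLe M h' z) = resOfLe M (h.trans h') z := by
  rw [← AddMonoidHom.comp_apply, resOfLe_comp_holds]

omit [NumberField K] in
/-- Naturality of restriction with conjugation, applied: `res (conj_σ z) = conj_σ (res z)`.
[cite: NeukirchSchmidtWingberg2008, I.§5] -/
theorem resOfLe_conjH1 {M : Type u} [AddCommGroup M] [DistribMulAction (Field.absoluteGaloisGroup K) M]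
    [TopologicalSpace M] [DiscreteTopology M] {H H' : Subgroup (Field.absoluteGaloisGroup K)}
    [H.Normal] [H'.Normal] (h : H ≤ H') (σ : Field.absoluteGaloisGroup K) (z : subgroupH1 H' M) :
    resOfLe M h (conjH1 H' M σ z) = conjH1 H M σ (resOfLe M h z) := by
  rw [← AddMonoidHom.comp_apply, resOfLe_comp_conjH1_holds, AddMonoidHom.comp_apply]

/-- **(D₂) The `γ₁`- and `γ₂`-invariant classes of `H¹(K̃_∞, M)` unramified outside `S` are finite**
(`M` finite discrete with continuous action, `p • M = 0`, `S ⊇ {v ∣ p}` finite): two-step descent —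
relative descent along `γ₂` into `H¹(K_∞^{(1)}, M)` (`exists_resOfLe_eq_of_conjH1_eq_pair`), finite
ambiguity of `γ₁`-invariance (`finite_ker_resOfLe_pair`), then the tree's one-variable finiteness
`WeierstrassCurve.finite_setOf_conjH1_eq_of_unramified_of` for `κ₁` (descent to `H¹(G_K, M; S)`,
Silverman X.4.3); inertia outside `p` lies in both kernels (`ZpExtension.inertia_le_kerSubgroup_holds`).
[cite: GreenbergLNM1716, §3 Lemma 3.2] [cite: SilvermanAEC2009, Lemma X.4.3] -/
theorem finite_setOf_conjH1_pair_eq_of_unramified {M : Type u} [AddCommGroup M]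
    [DistribMulAction (Field.absoluteGaloisGroup K) M] [TopologicalSpace M] [DiscreteTopology M]
    [Finite M] [ContinuousSMul (Field.absoluteGaloisGroup K) M]
    (hγ : ZpExtension.IsTopGeneratorPair κ₁ κ₂ γ₁ γ₂) (hpM : ∀ v : M, p • v = 0)
    {S : Set (HeightOneSpectrum (𝓞 K))} (hS : S.Finite)
    (hSp : ∀ v : HeightOneSpectrum (𝓞 K), (p : 𝓞 K) ∈ v.asIdeal → v ∈ S) :
    Set.Finite {x : subgroupH1 (ZpExtension.pairKer κ₁ κ₂) M |
      conjH1 (ZpExtension.pairKer κ₁ κ₂) M γ₁ x = x ∧ conjH1 (ZpExtension.pairKer κ₁ κ₂) M γ₂ x = x ∧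
      ∀ v : HeightOneSpectrum (𝓞 K), v ∉ S → ∀ 𝔓 ∈ v.primesAbove,
        ∀ hle : 𝔓.inertia (Field.absoluteGaloisGroup K) ≤ ZpExtension.pairKer κ₁ κ₂, resOfLe M hle x = 0} := by
  classical
  have hstab : ∀ v : M, IsOpen ((MulAction.stabilizer (Field.absoluteGaloisGroup K) v : Subgroup _) :
      Set (Field.absoluteGaloisGroup K)) := fun v ↦ by
    have : ((MulAction.stabilizer (Field.absoluteGaloisGroup K) v : Subgroup _) :
        Set (Field.absoluteGaloisGroup K)) = (fun g : Field.absoluteGaloisGroup K ↦ g • v) ⁻¹' {v} := by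
      ext g; simp [MulAction.mem_stabilizer_iff]
    rw [this]
    exact (isOpen_discrete ({v} : Set M)).preimage (continuous_id.smul continuous_const)
  -- notation
  let H := ZpExtension.pairKer κ₁ κ₂
  let N₁ := κ₁.kerSubgroup
  have hHN : H ≤ N₁ := ZpExtension.pairKer_le_left κ₁ κ₂
  let r : subgroupH1 N₁ M →+ subgroupH1 H M := resOfLe M hHN
  -- inertia outside `p` lies in `H` and in `N₁`
  have hIH : ∀ ⦃v : HeightOneSpectrum (𝓞 K)⦄, (p : 𝓞 K) ∉ v.asIdeal →
      ∀ ⦃𝔓 : Ideal (absIntegers (𝓞 K) K)⦄, 𝔓 ∈ v.primesAbove →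
        𝔓.inertia (Field.absoluteGaloisGroup K) ≤ H := fun v hv 𝔓 h𝔓 ↦
    le_inf (ZpExtension.inertia_le_kerSubgroup_holds K p κ₁ hv h𝔓)
      (ZpExtension.inertia_le_kerSubgroup_holds K p κ₂ hv h𝔓)
  have hIN₁ : ∀ ⦃v : HeightOneSpectrum (𝓞 K)⦄, (p : 𝓞 K) ∉ v.asIdeal →
      ∀ ⦃𝔓 : Ideal (absIntegers (𝓞 K) K)⦄, 𝔓 ∈ v.primesAbove →
        𝔓.inertia (Field.absoluteGaloisGroup K) ≤ N₁ := fun v hv 𝔓 h𝔓 ↦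
    ZpExtension.inertia_le_kerSubgroup_holds K p κ₁ hv h𝔓
  -- unramified predicates at the two levels
  let Unr : subgroupH1 H M → Prop := fun x ↦
    ∀ v : HeightOneSpectrum (𝓞 K), v ∉ S → ∀ 𝔓 ∈ v.primesAbove,
      ∀ hle : 𝔓.inertia (Field.absoluteGaloisGroup K) ≤ H, resOfLe M hle x = 0
  let Unr₁ : subgroupH1 N₁ M → Prop := fun z ↦
    ∀ v : HeightOneSpectrum (𝓞 K), v ∉ S → ∀ 𝔓 ∈ v.primesAbove,
      ∀ hle : 𝔓.inertia (Field.absoluteGaloisGroup K) ≤ N₁, resOfLe M hle z = 0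
  have hUnr₁_sub : ∀ z z', Unr₁ z → Unr₁ z' → Unr₁ (z - z') := fun z z' hz hz' v hv 𝔓 h𝔓 hle ↦ by
    rw [map_sub, hz v hv 𝔓 h𝔓 hle, hz' v hv 𝔓 h𝔓 hle, sub_zero]
  -- (one variable) the `γ₁`-invariant unramified classes of `H¹(N₁, M)` are finite
  have hA₁ := WeierstrassCurve.finite_setOf_conjH1_eq_of_unramified_of κ₁ (M := M) hγ.left hpM
    (finite_h1Unramified_holds K) hIN₁ hS hSp
  -- the kernel of `r` is finite
  have hF₁ := finite_ker_resOfLe_pair (M := M) hγ hstab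
  -- `Z = {z | Unr₁ z ∧ conj_{γ₁} z - z ∈ ker r}` is finite
  have hZ : Set.Finite {z : subgroupH1 N₁ M | Unr₁ z ∧ conjH1 N₁ M γ₁ z - z ∈ r.ker} := by
    have hsub : {z : subgroupH1 N₁ M | Unr₁ z ∧ conjH1 N₁ M γ₁ z - z ∈ r.ker} ⊆
        ⋃ f ∈ (r.ker : Set (subgroupH1 N₁ M)), {z | Unr₁ z ∧ conjH1 N₁ M γ₁ z - z = f} := by
      rintro z ⟨hz1, hz2⟩
      simp only [Set.mem_iUnion, Set.mem_setOf_eq, SetLike.mem_coe, exists_prop]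
      exact ⟨_, hz2, hz1, rfl⟩
    refine (hF₁.biUnion fun f _ ↦ ?_).subset hsub
    by_cases hne : {z : subgroupH1 N₁ M | Unr₁ z ∧ conjH1 N₁ M γ₁ z - z = f}.Nonempty
    · obtain ⟨z₀, hz₀U, hz₀⟩ := hne
      refine (hA₁.image fun a ↦ z₀ + a).subset ?_
      rintro z ⟨hzU, hz⟩
      refine ⟨z - z₀, ⟨?_, hUnr₁_sub z z₀ hzU hz₀U⟩, by abel⟩
      rw [map_sub, sub_eq_iff_eq_add.mp hz, sub_eq_iff_eq_add.mp hz₀]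
      abel
    · rw [Set.not_nonempty_iff_eq_empty.mp hne]
      exact Set.finite_empty
  -- the target set lies in `r '' Z`
  refine (hZ.image r).subset ?_
  rintro x ⟨hx1, hx2, hxU⟩
  obtain ⟨z, rfl⟩ := exists_resOfLe_eq_of_conjH1_eq_pair (M := M) hγ hstab hpM x hx2
  refine ⟨z, ⟨?_, ?_⟩, rfl⟩
  · intro v hv 𝔓 h𝔓 hle
    have hpv : (p : 𝓞 K) ∉ v.asIdeal := fun h ↦ hv (hSp v h)
    have hleH : 𝔓.inertia (Field.absoluteGaloisGroup K) ≤ H := hIH hpv h𝔓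
    rw [← resOfLe_resOfLe hleH hHN]
    exact hxU v hv 𝔓 h𝔓 hleH
  · rw [AddMonoidHom.mem_ker, map_sub, sub_eq_zero]
    change resOfLe M hHN (conjH1 N₁ M γ₁ z) = resOfLe M hHN z
    rw [resOfLe_conjH1]
    exact hx1

end General

/-! ## The registered stub (same short name + signature as in the skeleton `Cruxes/…/Lines/bdpline.lean`,
namespace of this Theorems file, as for `SignedBaseChangeAcDivControl.stub_controlSurjSS`) -/

/-- **Registered stub `stub_finitePieceSS` of line `bdpline` (v5): `H¹_{nr,v̄}(K̃_∞, E[p^∞])[𝔪]` is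
finite** — for any number field `K`, elliptic `W/K`, prime `p`, `ℤ_p`-extensions `κ₁, κ₂` with a
topological generator pair `(γ₁, γ₂)` and place `v̄`, the classes `s ∈ unrSelmer₂ κ₁ κ₂ E[p^∞] v̄` with
`p s = 0`, `conj_{γ₁} s = s`, `conj_{γ₂} s = s` form a finite set. Assembly as in the tree's
one-variable `WeierstrassCurve.finite_setOf_unramifiedOutside_pTorsion_conjH1_eq`: Kummer lift (A) with
finite kernel `F₀`, (B') `resOfLe_eq_zero_of_mem_unramifiedOutside`, and (D₂)
`finite_setOf_conjH1_pair_eq_of_unramified` with `S = {bad} ∪ {v ∣ p}`. Greenberg (1999) §1 p. 60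
("`X/𝔪X` is finite"), here for `X = X_Gr(E/K̃_∞)` over `Λ₂`.
[cite: GreenbergLNM1716, §1 p. 60 (after Conj. 1.3)] [cite: SilvermanAEC2009, Lemma X.4.3] -/
theorem stub_finitePieceSS :
    ∀ (K : Type) [Field K] [NumberField K] (W : WeierstrassCurve K) [W.IsElliptic] (p : ℕ) [Fact p.Prime] (κ₁ κ₂ : Literature.NumberTheory.EllipticCurves.ZpExtension K p) (vbar : IsDedekindDomain.HeightOneSpectrum (NumberField.RingOfIntegers K)) (γ₁ γ₂ : Field.absoluteGaloisGroup K), Literature.NumberTheory.EllipticCurves.ZpExtension.IsTopGeneratorPair κ₁ κ₂ γ₁ γ₂ → Set.Finite {s : Literature.NumberTheory.EllipticCurves.unrSelmer₂ κ₁ κ₂ (WeierstrassCurve.geomPrimaryTorsion W p) vbar | p • s = 0 ∧ Literature.NumberTheory.EllipticCurves.conjSel₂ κ₁ κ₂ (WeierstrassCurve.geomPrimaryTorsion W p) vbar γ₁ s = s ∧ Literature.NumberTheory.EllipticCurves.conjSel₂ κ₁ κ₂ (WeierstrassCurve.geomPrimaryTorsion W p) vbar γ₂ s = s} := by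
  intro K _ _ W _ p _ κ₁ κ₂ vbar γ₁ γ₂ hγ
  classical
  have hp := (Fact.out : p.Prime)
  -- notation
  let H := ZpExtension.pairKer κ₁ κ₂
  let ιN := W.torsionToPrimaryH1Sub p H
  -- the finite set of places
  let S : Set (HeightOneSpectrum (𝓞 K)) := W.badPlaces (𝓞 K) ∪ {v | ((p : ℤ) : 𝓞 K) ∈ v.asIdeal}
  have hbad : (W.badPlaces (𝓞 K)).Finite := W.finite_badPlaces_holds (𝓞 K)
  have hS : S.Finite := hbad.union (WeierstrassCurve.finite_setOf_intCast_mem_asIdeal (by exact_mod_cast hp.ne_zero))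
  have hSp : ∀ v : HeightOneSpectrum (𝓞 K), (p : 𝓞 K) ∈ v.asIdeal → v ∈ S := fun v hv ↦
    Or.inr (by simpa using hv)
  -- unramified predicate on `H¹(H, E[p])`
  let Unr : subgroupH1 H (WeierstrassCurve.geomTorsion W (p : ℤ)) → Prop := fun x ↦
    ∀ v : HeightOneSpectrum (𝓞 K), v ∉ S → ∀ 𝔓 ∈ v.primesAbove,
      ∀ hle : 𝔓.inertia (Field.absoluteGaloisGroup K) ≤ H,
        resOfLe (WeierstrassCurve.geomTorsion W (p : ℤ)) hle x = 0
  have hUnr_sub : ∀ x y, Unr x → Unr y → Unr (x - y) := fun x y hx hy v hv 𝔓 h𝔓 hle ↦ by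
    rw [map_sub, hx v hv 𝔓 h𝔓 hle, hy v hv 𝔓 h𝔓 hle, sub_zero]
  -- (D₂) the doubly invariant unramified classes are finite
  haveI : Finite (WeierstrassCurve.geomTorsion W (p : ℤ)) :=
    WeierstrassCurve.finite_torsionPoints_holds W (AlgebraicClosure K) (by exact_mod_cast hp.ne_zero)
  haveI : ContinuousSMul (Field.absoluteGaloisGroup K) (WeierstrassCurve.geomTorsion W (p : ℤ)) :=
    WeierstrassCurve.continuousSMul_geomTorsion W (WeierstrassCurve.isOpen_stabilizer_point_holds W) _
  have hpM : ∀ m : WeierstrassCurve.geomTorsion W (p : ℤ), p • m = 0 := fun m ↦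
    Subtype.ext (by rw [AddSubgroupClass.coe_nsmul, ZeroMemClass.coe_zero]; exact
      AddSubgroup.torsionBy.nsmul_iff.mp m.2)
  have hA₀ := finite_setOf_conjH1_pair_eq_of_unramified (M := WeierstrassCurve.geomTorsion W (p : ℤ))
    hγ hpM hS hSp
  -- (A) the kernel of `ιN` is finite
  have hF₀ := W.finite_ker_torsionToPrimaryH1Sub p (H := H) W.zsmul_geomPoints_surjective_holds
  -- the lifts `L = {y | ιN y ∈ unrSelmer₂, conj_{γ_i} (ιN y) = ιN y}` form a finite set
  have hL : Set.Finite {y : subgroupH1 H (WeierstrassCurve.geomTorsion W (p : ℤ)) |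
      ιN y ∈ unrSelmer₂ κ₁ κ₂ (WeierstrassCurve.geomPrimaryTorsion W p) vbar ∧
        W.conjH1 p H γ₁ (ιN y) = ιN y ∧ W.conjH1 p H γ₂ (ιN y) = ιN y} := by
    -- `L ⊆ ⋃_{f₁, f₂ ∈ ker ιN} {y | Unr y ∧ conj₁ y - y = f₁ ∧ conj₂ y - y = f₂}`
    have hsub : {y : subgroupH1 H (WeierstrassCurve.geomTorsion W (p : ℤ)) |
        ιN y ∈ unrSelmer₂ κ₁ κ₂ (WeierstrassCurve.geomPrimaryTorsion W p) vbar ∧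
          W.conjH1 p H γ₁ (ιN y) = ιN y ∧ W.conjH1 p H γ₂ (ιN y) = ιN y} ⊆
        ⋃ f₁ ∈ (ιN.ker : Set _), ⋃ f₂ ∈ (ιN.ker : Set _), {y | Unr y ∧
          conjH1 H (WeierstrassCurve.geomTorsion W (p : ℤ)) γ₁ y - y = f₁ ∧
          conjH1 H (WeierstrassCurve.geomTorsion W (p : ℤ)) γ₂ y - y = f₂} := by
      rintro y ⟨hy0, hy1, hy2⟩
      simp only [Set.mem_iUnion, Set.mem_setOf_eq, SetLike.mem_coe, exists_prop]
      refine ⟨_, ?_, _, ?_, ?_, rfl, rfl⟩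
      · rw [AddMonoidHom.mem_ker, map_sub, ← WeierstrassCurve.conjH1_torsionToPrimaryH1Sub, hy1, sub_self]
      · rw [AddMonoidHom.mem_ker, map_sub, ← WeierstrassCurve.conjH1_torsionToPrimaryH1Sub, hy2, sub_self]
      · intro v hv 𝔓 h𝔓 hle
        have hv' : v ∉ W.badPlaces (𝓞 K) := fun h ↦ hv (Or.inl h)
        have hpv : ((p : ℕ) : 𝓞 K) ∉ v.asIdeal := fun h ↦ hv (hSp v h)
        exact W.resOfLe_eq_zero_of_mem_unramifiedOutside (H := H) (S₀ := ∅)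
          (unrSelmer₂_le_unramifiedOutside κ₁ κ₂ _ vbar hy0) (Set.notMem_empty v) hv' hpv h𝔓 hle
    refine (hF₀.biUnion fun f₁ _ ↦ hF₀.biUnion fun f₂ _ ↦ ?_).subset hsub
    -- each piece is empty or a translate of the finite set of (D₂)
    by_cases hne : {y | Unr y ∧ conjH1 H (WeierstrassCurve.geomTorsion W (p : ℤ)) γ₁ y - y = f₁ ∧
        conjH1 H (WeierstrassCurve.geomTorsion W (p : ℤ)) γ₂ y - y = f₂}.Nonempty
    · obtain ⟨y₀, hy₀U, hy₀1, hy₀2⟩ := hne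
      refine (hA₀.image fun a ↦ y₀ + a).subset ?_
      rintro y ⟨hyU, hy1, hy2⟩
      refine ⟨y - y₀, ⟨?_, ?_, hUnr_sub y y₀ hyU hy₀U⟩, by abel⟩
      · rw [map_sub, sub_eq_iff_eq_add.mp hy1, sub_eq_iff_eq_add.mp hy₀1]
        abel
      · rw [map_sub, sub_eq_iff_eq_add.mp hy2, sub_eq_iff_eq_add.mp hy₀2]
        abel
    · rw [Set.not_nonempty_iff_eq_empty.mp hne]
      exact Set.finite_empty
  -- conclusion: the target set is the preimage under the (injective) coercion of a subset of `ιN '' L`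
  refine ((hL.image ιN).preimage (Subtype.val_injective.injOn)).subset ?_
  rintro s ⟨hs0, hs1, hs2⟩
  have hps : p • (s : W.subgroupH1 p H) = 0 := by
    rw [← AddSubgroupClass.coe_nsmul, hs0, ZeroMemClass.coe_zero]
  obtain ⟨y, hy⟩ := W.exists_torsionToPrimaryH1Sub_eq p (H := H) W.zsmul_geomPoints_surjective_holds hps
  refine ⟨y, ⟨?_, ?_, ?_⟩, hy⟩
  · show ιN y ∈ unrSelmer₂ κ₁ κ₂ (WeierstrassCurve.geomPrimaryTorsion W p) vbar
    rw [show ιN y = (s : W.subgroupH1 p H) from hy]; exact s.2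
  · show W.conjH1 p H γ₁ (ιN y) = ιN y
    rw [show ιN y = (s : W.subgroupH1 p H) from hy]
    exact congrArg (fun z : unrSelmer₂ κ₁ κ₂ (WeierstrassCurve.geomPrimaryTorsion W p) vbar ↦
      (z : W.subgroupH1 p H)) hs1
  · show W.conjH1 p H γ₂ (ιN y) = ιN y
    rw [show ιN y = (s : W.subgroupH1 p H) from hy]
    exact congrArg (fun z : unrSelmer₂ κ₁ κ₂ (WeierstrassCurve.geomPrimaryTorsion W p) vbar ↦
      (z : W.subgroupH1 p H)) hs2

end Summit.BirchSwinnertonDyer.BirchSwinnertonDyer.Theorems.SignedBaseChangeAcDivFinitePiece
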